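import Summits.BirchSwinnertonDyer.BirchSwinnertonDyer.Theorems.AdditiveKolyvaginRoadRamifiedHabitatSignLawIZeroStarAnyLevel
import Summits.BirchSwinnertonDyer.BirchSwinnertonDyer.Theorems.AdditiveKolyvaginRoadRamifiedHabitatSignLawPotMult
import HarnessLib

/-!
# Route `AdditiveKolyvaginRoad`, crux KS′ `LevelKolyvaginSystemsAdditive` (stmt-BirchSwinnertonDyer-21396), card `ramified-toric-habitat` —
# the additive POTENTIALLY MULTIPLICATIVE row for ARBITRARY reduction off `p`, purely modular at `p`

Cell `pub/bsd-wall`, width seat `bsd-wall-akr-p2x-w2` g12; `--supports stmt-BirchSwinnertonDyer-21396` (helper). THEOREMS ONLY; no definition,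
no named fact, no `sorry`. BSD is not proved by any of this; KS′/KPA′ stay OPEN at `p² ∣ N`.

g11's part 11 (`…RamifiedHabitatSignLawPotMult`) proves, for `M` SQUAREFREE and assuming only the Modularity Theorem, that on the additive
potentially multiplicative row (`ord_p c₄ = 2`, `ord_p Δ > 6` on the minimal model; `E' = E^{(p*)}` MULTIPLICATIVE at `p`, `N_{E'} = M p`) the habitat
sign is `w(E)·w(E^{(d)}) = −(d'/p)·W_p(E')` — it FLIPS with `(d'/p)`, the content of the misstatement datum (evidence #41) for the sketch's
`SignLawPrincipalSeries`. The squarefree hypothesis entered twice: the Atkin–Lehner-formal ratio (`λ_q = −a_q` at `q ∥ N`) and the guard «no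
additive reduction at `2, 3`» of `atkinLehnerEigenvalueAt_eq_localRootNumberAt_of_twist` used to read `λ_p(f) = W_p(E)`. Both are bypassed here as
in `…SignLawIZeroStarAnyLevel`: `f = (f')_χ` with `f'` of level `M p ∣ M p` gives `λ_p(f) = χ(−1) = (−1/p)` on the MODULAR side
(`atkinLehnerEigenvalueAt_eq_χ₄_of_cuspCoeff_eq`), the eigenvalues at `q ∣ M` pair off by the Atkin–Li commutation rule
(`atkinLehnerEigenvalueAt_mul_eq_legendreSym_pow_of_cuspCoeff`), and `λ_p(f') = W_p(E')` at the MULTIPLICATIVE prime `p ∥ N_{E'}` is the tree's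
theorem `atkinLehnerEigenvalueAt_eq_localRootNumberAt_of_not_sq_dvd` (no guard). Hence, for EVERY `M` prime to `p`, assuming ONLY `exists_isNewformOf`:

* §18 `rootNumber_mul_rootNumber_pStarTwist_eq_legendreSym_mul_χ₄_mul_of_mult` — `N_E = M p²`, `N_{E'} = M p` ⟹ `w(E)·w(E') = (M/p)·(−1/p)·λ_p(f')`;
  `rootNumber_mul_rootNumber_pStarTwist_of_potMult_anyLevel` — `= (M/p)·(−1/p)·W_p(E^{(p*)})`;
  `rootNumber_mul_rootNumber_ramifiedTwist_of_potMult_anyLevel` — in the habitat `w(E)·w(E^{(d)}) = −(d'/p)·W_p(E^{(p*)})`.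

With `…SignLawAnyLevelSketch` (supercuspidal `+1`), `…SignLawIZeroStarAnyLevel` (principal series `−1` on every potentially good row) this completes
the card's sign table at EVERY additive `p ≥ 5` for `E` with ARBITRARY reduction elsewhere and odd `d_{K′}` (even `d_{K′}`: akr-p2x-w3 g13's lane).

References: [cite: ShemanskeWalling1993, Prop. 5.4] [cite: AtkinLehner1970, §6] [cite: Knapp1993, Thm. 9.27] [cite: MurtyMurty1997, Ch. 6 §1]
[cite: Rohrlich1993Compositio, Prop. 2(ii),(iii)] [cite: KellockDokchitser2023, Rem. 2.2 and Thm. 2.3].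
-/

set_option autoImplicit false
set_option linter.dupNamespace false

noncomputable section

open scoped Classical MatrixGroups NumberTheorySymbols

open CongruenceSubgroup IsDedekindDomain IsDedekindDomain.HeightOneSpectrum NumberField Rat.HeightOneSpectrum
  WeierstrassCurve Literature.NumberTheory.EllipticCurves Literature.NumberTheory.EllipticCurves.ModularForms
  IsDiscreteValuationRing

namespace Summit.BirchSwinnertonDyer.BirchSwinnertonDyer.Theorems.AdditiveKoly.RamifiedHabitat

/-! ## §18 The potentially multiplicative row, any `M` -/

section PotMult

variable {p : ℕ} [Fact p.Prime]

/-- **`w(E)·w(E') = (M/p)·(−1/p)·λ_p(f')` when `N_E = M p²` and `N_{E'} = M p`, for EVERY `M` prime to `p`, from `IsNewformOf` data alone**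
(`E' = E^{(p*)}` multiplicative at `p`): `f = (f')_χ` by `q`-expansion (`E` additive at `p`), `λ_p(f) = χ(−1) = (−1/p)` since `f'` has level
`M p ∣ M p` (`atkinLehnerEigenvalueAt_eq_χ₄_of_cuspCoeff_eq`, Atkin–Lehner 1970 §6), and at `q ∣ M`: `λ_q(f)λ_q(f') = (q^{v_q(N)}/p)`
(`atkinLehnerEigenvalueAt_mul_eq_legendreSym_pow_of_cuspCoeff`; `v_q(M p) = v_q(M p²)`). g11's `…_of_mult` is the case `M` squarefree with
`λ_p(f)` symbolic. [cite: Knapp1993, Thm. 9.27] [cite: AtkinLehner1970, §6] [cite: ShemanskeWalling1993, Prop. 5.4] -/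
theorem rootNumber_mul_rootNumber_pStarTwist_eq_legendreSym_mul_χ₄_mul_of_mult (W : WeierstrassCurve ℚ) [W.IsElliptic]
    [NeZero (W.conductorNorm ℤ)] (hp2 : p ≠ 2) {M : ℕ} (hN : W.conductorNorm ℤ = M * p ^ 2) (hpM : ¬ p ∣ M)
    [(W.quadraticTwist (((-1 : ℤ) ^ (p / 2) * p : ℤ) : ℚ)).IsElliptic]
    [NeZero ((W.quadraticTwist (((-1 : ℤ) ^ (p / 2) * p : ℤ) : ℚ)).conductorNorm ℤ)]
    (hN' : (W.quadraticTwist (((-1 : ℤ) ^ (p / 2) * p : ℤ) : ℚ)).conductorNorm ℤ = M * p)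
    {f : CuspForm (Gamma0 (W.conductorNorm ℤ)) 2} (hf : IsNewformOf W f)
    {f' : CuspForm (Gamma0 ((W.quadraticTwist (((-1 : ℤ) ^ (p / 2) * p : ℤ) : ℚ)).conductorNorm ℤ)) 2}
    (hf' : IsNewformOf (W.quadraticTwist (((-1 : ℤ) ^ (p / 2) * p : ℤ) : ℚ)) f') :
    ((W.rootNumber * (W.quadraticTwist (((-1 : ℤ) ^ (p / 2) * p : ℤ) : ℚ)).rootNumber : ℤ) : ℂ) =
      legendreSym p M * ZMod.χ₄ p * atkinLehnerEigenvalueAt f' p := by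
  have hp : p.Prime := Fact.out
  have hw : (W.rootNumber : ℂ) = -frickeEigenvalue f :=
    Literature.NumberTheory.EllipticCurves.rootNumber_eq_neg_of_frickeInvolution_eq_smul W hf
      (IsNewform0.frickeEigenvalue_eq_one_or_eq_neg_one_holds hf.1) (IsNewform0.frickeInvolution_eq_smul_holds hf.1)
  have hw' : ((W.quadraticTwist (((-1 : ℤ) ^ (p / 2) * p : ℤ) : ℚ)).rootNumber : ℂ) = -frickeEigenvalue f' :=
    Literature.NumberTheory.EllipticCurves.rootNumber_eq_neg_of_frickeInvolution_eq_smul _ hf'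
      (IsNewform0.frickeEigenvalue_eq_one_or_eq_neg_one_holds hf'.1) (IsNewform0.frickeInvolution_eq_smul_holds hf'.1)
  have hε := IsNewform0.frickeEigenvalue_eq_prod_atkinLehnerEigenvalueAt_holds hf.1
  have hε' := IsNewform0.frickeEigenvalue_eq_prod_atkinLehnerEigenvalueAt_holds hf'.1
  have hM0 : M ≠ 0 := fun h ↦ NeZero.ne (W.conductorNorm ℤ) (by rw [hN, h, zero_mul])
  have hpf : (W.conductorNorm ℤ).primeFactors = insert p M.primeFactors := by
    rw [hN, Nat.primeFactors_mul hM0 (pow_ne_zero 2 hp.ne_zero), Nat.primeFactors_pow _ two_ne_zero, hp.primeFactors,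
      Finset.union_comm]
    rfl
  have hpf' : ((W.quadraticTwist (((-1 : ℤ) ^ (p / 2) * p : ℤ) : ℚ)).conductorNorm ℤ).primeFactors = insert p M.primeFactors := by
    rw [hN', Nat.primeFactors_mul hM0 hp.ne_zero, hp.primeFactors, Finset.union_comm]
    rfl
  have hpnot : p ∉ M.primeFactors := fun h ↦ hpM (Nat.dvd_of_mem_primeFactors h)
  -- levels
  have hN'N : (W.quadraticTwist (((-1 : ℤ) ^ (p / 2) * p : ℤ) : ℚ)).conductorNorm ℤ ∣ W.conductorNorm ℤ := by
    rw [hN', hN]; exact ⟨p, by ring⟩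
  have hN'Mp : (W.quadraticTwist (((-1 : ℤ) ^ (p / 2) * p : ℤ) : ℚ)).conductorNorm ℤ ∣ M * p := by rw [hN']
  have hpN : p ^ 2 ∣ W.conductorNorm ℤ := hN ▸ Dvd.intro_left M rfl
  -- `W` is additive at `p`: `aₙ(f) = (n/p) aₙ(f')`
  set P : Nat.Primes := ⟨p, hp⟩ with hP
  have hgen : natGenerator ((primesEquiv (R := ℤ)).symm P) = p :=
    congrArg (fun r : Nat.Primes ↦ (r : ℕ)) ((primesEquiv (R := ℤ)).apply_symm_apply P)
  have h2 : 2 ≤ W.conductorExponent ((primesEquiv (R := ℤ)).symm P) := by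
    rw [← factorization_conductorNorm_holds W ((primesEquiv (R := ℤ)).symm P), hgen]
    exact (hp.pow_dvd_iff_le_factorization (NeZero.ne _)).mp hpN
  have hadd : W.HasAdditiveReductionAt ((primesEquiv (R := ℤ)).symm P) := (two_le_conductorExponent_iff_holds _ W).mp h2
  set v : HeightOneSpectrum (𝓞 ℚ) := (primesEquiv (R := 𝓞 ℚ)).symm P with hvdef
  have hvp : (primesEquiv v : ℕ) = p := by rw [hvdef, Equiv.apply_symm_apply]
  have haddO : W.HasAdditiveReductionAt v := (W.hasAdditiveReductionAt_int_iff_ringOfIntegers P).mp hadd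
  have hcoeff : ∀ n : ℕ, cuspCoeff f n = (legendreSym p n : ℂ) * cuspCoeff f' n :=
    W.cuspCoeff_eq_legendreSym_mul_cuspCoeff hp2 hvp haddO hf hf'
  have hf0 : f ≠ 0 := fun h0 ↦ hf.1.coe_ne_zero (by rw [h0]; rfl)
  -- AT `p`, modular side: `λ_p(f) = χ(−1)`
  have hlp : atkinLehnerEigenvalueAt f p = (ZMod.χ₄ p : ℂ) := atkinLehnerEigenvalueAt_eq_χ₄_of_cuspCoeff_eq hp2 hN hpM hN'Mp hf0 hcoeff
  -- at `q ∣ M`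
  have hq : ∀ q ∈ M.primeFactors, atkinLehnerEigenvalueAt f q * atkinLehnerEigenvalueAt f' q =
      legendreSym p (q ^ (W.conductorNorm ℤ).factorization q : ℕ) := by
    intro q hqM
    have hqdM : q ∣ M := Nat.dvd_of_mem_primeFactors hqM
    have hqp : q ≠ p := fun h ↦ hpnot (h ▸ hqM)
    have hqN : q ∈ (W.conductorNorm ℤ).primeFactors := hpf ▸ Finset.mem_insert_of_mem hqM
    have hqN' : q ∣ (W.quadraticTwist (((-1 : ℤ) ^ (p / 2) * p : ℤ) : ℚ)).conductorNorm ℤ := hN' ▸ hqdM.mul_right p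
    have hv : ((W.quadraticTwist (((-1 : ℤ) ^ (p / 2) * p : ℤ) : ℚ)).conductorNorm ℤ).factorization q =
        (W.conductorNorm ℤ).factorization q := by
      rw [hN', hN, Nat.factorization_mul hM0 (pow_ne_zero 2 hp.ne_zero), Nat.factorization_mul hM0 hp.ne_zero, Finsupp.add_apply,
        Finsupp.add_apply, hp.factorization_pow, hp.factorization, Finsupp.single_apply, Finsupp.single_apply, if_neg (Ne.symm hqp),
        if_neg (Ne.symm hqp)]
    exact atkinLehnerEigenvalueAt_mul_eq_legendreSym_pow_of_cuspCoeff hp2 hN'N hpN hf.1 hf'.1 hcoeff hqN hqp hqN' hv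
  -- `∏_{q ∣ M} (q^{v_q(N)}/p) = (M/p)`
  have hfac : ∀ q ∈ M.primeFactors, (W.conductorNorm ℤ).factorization q = M.factorization q := by
    intro q hqM
    have hqp : q ≠ p := fun h ↦ hpnot (h ▸ hqM)
    rw [hN, Nat.factorization_mul hM0 (pow_ne_zero 2 hp.ne_zero), Finsupp.add_apply, hp.factorization_pow,
      Finsupp.single_apply, if_neg (Ne.symm hqp), add_zero]
  have hleg : ∏ q ∈ M.primeFactors, (legendreSym p (q ^ (W.conductorNorm ℤ).factorization q : ℕ) : ℂ) = legendreSym p M := by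
    conv_rhs => rw [Nat.prod_primeFactors_pow_factorization hM0]
    rw [Nat.cast_prod, ← legendreSym.hom_apply, map_prod]
    push_cast
    refine Finset.prod_congr rfl fun q hqM ↦ ?_
    rw [legendreSym.hom_apply, hfac q hqM]
  -- assemble
  rw [Int.cast_mul, hw, hw', hε, hε', hpf, hpf', Finset.prod_insert hpnot, Finset.prod_insert hpnot, neg_mul_neg, hlp, mul_mul_mul_comm,
    ← Finset.prod_mul_distrib, Finset.prod_congr rfl hq, hleg]
  ring

/-- **POTENTIALLY MULTIPLICATIVE `p`, ANY `M`: `w(E)·w(E^{(p*)}) = (M/p)·(−1/p)·W_p(E^{(p*)})`, assuming only the Modularity Theorem.** `E/ℚ` of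
conductor `N = M p²` (`p ≥ 5`, `p ∤ M`, NO further hypothesis on `M`) whose minimal model at `p` has `ord_p c₄ = 2`, `ord_p Δ = a > 6` (additive,
potentially multiplicative). Then `E' = E^{(p*)}` is MULTIPLICATIVE at `p`, `N_{E'} = M p` (g11 part 10), and `λ_p(f') = W_p(E')` at `p ∥ N_{E'}` is
the tree's THEOREM `atkinLehnerEigenvalueAt_eq_localRootNumberAt_of_not_sq_dvd`; the rest is §18's modular identity.
[cite: KellockDokchitser2023, Rem. 2.2 and Thm. 2.3] [cite: Rohrlich1993Compositio, Prop. 2(ii),(iii)] [cite: AtkinLehner1970, §6] -/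
theorem rootNumber_mul_rootNumber_pStarTwist_of_potMult_anyLevel (W : WeierstrassCurve ℚ) [W.IsElliptic] (hmod : exists_isNewformOf)
    (hp5 : 5 ≤ p) {M : ℕ} (hN : W.conductorNorm ℤ = M * p ^ 2) (hpM : ¬ p ∣ M) {a : ℕ}
    (hΔ : addVal ℤ_[p] (((W.baseChange ℚ_[p]).minimal ℤ_[p]).integralModel ℤ_[p]).Δ = a) (ha : 6 < a)
    (hc₄ : addVal ℤ_[p] (((W.baseChange ℚ_[p]).minimal ℤ_[p]).integralModel ℤ_[p]).c₄ = 2) :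
    W.rootNumber * (W.quadraticTwist (((-1 : ℤ) ^ (p / 2) * p : ℤ) : ℚ)).rootNumber =
      legendreSym p M * ZMod.χ₄ p *
        ((W.quadraticTwist (((-1 : ℤ) ^ (p / 2) * p : ℤ) : ℚ)).baseChange ℚ_[p]).localRootNumber ℤ_[p] := by
  have hp : p.Prime := Fact.out
  have hp2 : p ≠ 2 := by omega
  have hdZ0 : ((-1 : ℤ) ^ (p / 2) * p : ℤ) ≠ 0 :=
    mul_ne_zero (pow_ne_zero _ (by norm_num)) (by exact_mod_cast hp.ne_zero)
  have hd0 : (((((-1 : ℤ) ^ (p / 2) * p : ℤ)) : ℚ)) ≠ 0 := by exact_mod_cast hdZ0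
  haveI hE' : (W.quadraticTwist (((-1 : ℤ) ^ (p / 2) * p : ℤ) : ℚ)).IsElliptic := W.isElliptic_quadraticTwist hd0
  haveI : NeZero (W.conductorNorm ℤ) := ⟨(W.conductorNorm_pos_holds).ne'⟩
  haveI : NeZero ((W.quadraticTwist (((-1 : ℤ) ^ (p / 2) * p : ℤ) : ℚ)).conductorNorm ℤ) :=
    ⟨((W.quadraticTwist _).conductorNorm_pos_holds).ne'⟩
  obtain ⟨-, hmult, -⟩ := hasMultiplicativeReduction_pStarTwist_padic_of_potMult W hp5 hΔ ha hc₄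
  have hN' := conductorNorm_pStarTwist_eq_mul_of_mult W hp5 hN hpM hmult
  obtain ⟨f, hf⟩ := hmod W
  obtain ⟨f', hf'⟩ := hmod (W.quadraticTwist (((-1 : ℤ) ^ (p / 2) * p : ℤ) : ℚ))
  have h0 := rootNumber_mul_rootNumber_pStarTwist_eq_legendreSym_mul_χ₄_mul_of_mult W hp2 hN hpM hN' hf hf'
  -- `λ_p(f') = W_p(E')` at the multiplicative prime `p ∥ N_{E'}` (a theorem of the tree)
  set P : Nat.Primes := ⟨p, hp⟩ with hP
  have hPN' : (P : ℕ) ∣ (W.quadraticTwist (((-1 : ℤ) ^ (p / 2) * p : ℤ) : ℚ)).conductorNorm ℤ := by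
    change p ∣ _; rw [hN']; exact ⟨M, by ring⟩
  have hPN'2 : ¬ (P : ℕ) ^ 2 ∣ (W.quadraticTwist (((-1 : ℤ) ^ (p / 2) * p : ℤ) : ℚ)).conductorNorm ℤ := by
    change ¬ p ^ 2 ∣ _; rw [hN']
    rintro ⟨k, hk⟩
    apply hpM
    refine ⟨k, Nat.eq_of_mul_eq_mul_right hp.pos ?_⟩
    calc M * p = p ^ 2 * k := hk
      _ = p * k * p := by ring
  have hl' : atkinLehnerEigenvalueAt f' p =
      (((W.quadraticTwist (((-1 : ℤ) ^ (p / 2) * p : ℤ) : ℚ)).baseChange ℚ_[p]).localRootNumber ℤ_[p] : ℂ) := by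
    rw [← localRootNumberAt_primesEquiv_symm_holds _ P]
    exact (W.quadraticTwist _).atkinLehnerEigenvalueAt_eq_localRootNumberAt_of_not_sq_dvd hf' P hPN' hPN'2
  rw [hl'] at h0
  exact_mod_cast h0

/-- **THE POTENTIALLY MULTIPLICATIVE ROW OF THE HABITAT, ANY `M`: the sign DEPENDS ON `d'`.** `E` as in
`rootNumber_mul_rootNumber_pStarTwist_of_potMult_anyLevel` (NO hypothesis on `M` beyond `p ∤ M`); `d = p*·d'` (`d' ≡ 1 (4)` squarefree prime to `N`,
`d < 0`), every prime of `M` split in `ℚ(√d)`. Then, assuming ONLY the Modularity Theorem, `w(E)·w(E^{(d)}) = −(d'/p)·W_p(E^{(p*)})` — it FLIPS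
with the class of `d'` mod `p`, so the sketch's `SignLawPrincipalSeries` is false on these rows for every `E` (evidence #41; g11 part 11 for `M`
squarefree). [cite: MurtyMurty1997, Ch. 6 §1] [cite: Rohrlich1993Compositio, Prop. 2(ii),(iii)] [cite: KellockDokchitser2023, Rem. 2.2] -/
theorem rootNumber_mul_rootNumber_ramifiedTwist_of_potMult_anyLevel (W : WeierstrassCurve ℚ) [W.IsElliptic] (hmod : exists_isNewformOf)
    (hp5 : 5 ≤ p) {M : ℕ} (hN : W.conductorNorm ℤ = M * p ^ 2) (hpM : ¬ p ∣ M) {a : ℕ}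
    (hΔ : addVal ℤ_[p] (((W.baseChange ℚ_[p]).minimal ℤ_[p]).integralModel ℤ_[p]).Δ = a) (ha : 6 < a)
    (hc₄ : addVal ℤ_[p] (((W.baseChange ℚ_[p]).minimal ℤ_[p]).integralModel ℤ_[p]).c₄ = 2)
    {d' : ℤ} (hd'4 : d' % 4 = 1) (hd'sq : Squarefree d') (hgcd : Int.gcd d' (W.conductorNorm ℤ) = 1)
    (hneg : (-1 : ℤ) ^ (p / 2) * p * d' < 0)
    (hodd : ∀ q ∈ M.primeFactors, q ≠ 2 → J((-1 : ℤ) ^ (p / 2) * p * d' | q) = 1)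
    (htwo : 2 ∣ M → ((-1 : ℤ) ^ (p / 2) * p * d') % 8 = 1) :
    W.rootNumber * (W.quadraticTwist (((-1 : ℤ) ^ (p / 2) * p * d' : ℤ) : ℚ)).rootNumber =
      -legendreSym p d' * ((W.quadraticTwist (((-1 : ℤ) ^ (p / 2) * p : ℤ) : ℚ)).baseChange ℚ_[p]).localRootNumber ℤ_[p] := by
  have hp : p.Prime := Fact.out
  have hp2 : p ≠ 2 := by omega
  have hdZ0 : ((-1 : ℤ) ^ (p / 2) * p : ℤ) ≠ 0 :=
    mul_ne_zero (pow_ne_zero _ (by norm_num)) (by exact_mod_cast hp.ne_zero)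
  have hd0 : (((((-1 : ℤ) ^ (p / 2) * p : ℤ)) : ℚ)) ≠ 0 := by exact_mod_cast hdZ0
  haveI hE' : (W.quadraticTwist (((-1 : ℤ) ^ (p / 2) * p : ℤ) : ℚ)).IsElliptic := W.isElliptic_quadraticTwist hd0
  have hM0 : M ≠ 0 := by
    intro h; rw [h, zero_mul] at hN; exact (W.conductorNorm_pos_holds).ne' hN
  have hA := rootNumber_mul_rootNumber_pStarTwist_of_potMult_anyLevel W hmod hp5 hN hpM hΔ ha hc₄
  obtain ⟨-, hmult, -⟩ := hasMultiplicativeReduction_pStarTwist_padic_of_potMult W hp5 hΔ ha hc₄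
  have hN' := conductorNorm_pStarTwist_eq_mul_of_mult W hp5 hN hpM hmult
  have hgcd' : Int.gcd d' ((W.quadraticTwist (((-1 : ℤ) ^ (p / 2) * p : ℤ) : ℚ)).conductorNorm ℤ) = 1 := by
    rw [hN']
    have h1 := Int.isCoprime_iff_gcd_eq_one.mpr hgcd
    rw [hN] at h1
    push_cast at h1 ⊢
    rw [sq, ← mul_assoc] at h1
    exact Int.isCoprime_iff_gcd_eq_one.mp h1.of_mul_right_left
  have hB := ((W.quadraticTwist (((-1 : ℤ) ^ (p / 2) * p : ℤ) : ℚ)).rootNumber_quadraticTwist_of_emod_four_eq_one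
    hmod hd'4 hd'sq hgcd').1
  rw [quadraticTwist_quadraticTwist, hN'] at hB
  have hcast : ((((-1 : ℤ) ^ (p / 2) * p : ℤ) : ℚ)) * (d' : ℚ) = (((-1 : ℤ) ^ (p / 2) * p * d' : ℤ) : ℚ) := by push_cast; ring
  rw [hcast] at hB
  have hNe0 : NeZero d'.natAbs := ⟨Int.natAbs_ne_zero.mpr (by rintro rfl; norm_num at hd'4)⟩
  -- `(M p / |d'|) = (M/p)·(d'/p)`
  have hpodd : Odd p := (Nat.Prime.eq_two_or_odd' hp).resolve_left hp2
  have hJM : J(((M * p : ℕ) : ℤ) | d'.natAbs) = legendreSym p M * legendreSym p d' := by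
    rw [Nat.cast_mul, jacobiSym.mul_left, jacobiSym_natAbs_eq_legendreSym_of_split_anyLevel hp2 hd'4 hM0 hodd htwo,
      Literature.NumberTheory.QuadraticFields.jacobiSym_natAbs_eq_of_emod_four_eq_one hd'4 hpodd, ← jacobiSym.legendreSym.to_jacobiSym]
  have hJ1 := jacobiSym_neg_one_natAbs_eq_of_neg hp2 hd'4 hneg
  have hM2 : legendreSym p M * legendreSym p M = 1 := by
    rw [← sq]
    refine legendreSym.sq_one p ?_
    rw [Int.cast_natCast, ne_eq, ZMod.natCast_eq_zero_iff]
    exact hpM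
  have hχ₄ := χ₄_mul_self_of_ne_two (p := p) hp2
  set w' := ((W.quadraticTwist (((-1 : ℤ) ^ (p / 2) * p : ℤ) : ℚ)).baseChange ℚ_[p]).localRootNumber ℤ_[p]
  calc W.rootNumber * (W.quadraticTwist (((-1 : ℤ) ^ (p / 2) * p * d' : ℤ) : ℚ)).rootNumber
      = J(-1 | d'.natAbs) * J(((M * p : ℕ) : ℤ) | d'.natAbs) *
          (W.rootNumber * (W.quadraticTwist (((-1 : ℤ) ^ (p / 2) * p : ℤ) : ℚ)).rootNumber) := by rw [hB]; ring
    _ = -ZMod.χ₄ p * (legendreSym p M * legendreSym p d') * (legendreSym p M * ZMod.χ₄ p * w') := by rw [hJ1, hJM, hA]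
    _ = -legendreSym p d' * w' := by
        linear_combination (-(legendreSym p d') * w' * (ZMod.χ₄ p * ZMod.χ₄ p)) * hM2 - (legendreSym p d' * w') * hχ₄

end PotMult

end Summit.BirchSwinnertonDyer.BirchSwinnertonDyer.Theorems.AdditiveKoly.RamifiedHabitat

end
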